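import Summits.BirchSwinnertonDyer.BirchSwinnertonDyer.Theorems.AlignedTransportAtTwoMainConjectureTransportAlignedAtTwoAddTwistCoefficients
import HarnessLib

/-!
# Route `AlignedTransportAtTwo`, crux C1 `MainConjectureTransportAlignedAtTwo` (stmt-BirchSwinnertonDyer-22296), line `birth` —
# the BOTH-ADDITIVE twist sub-cell, part 3b (BIRCH): the newform of a both-additive twist as Shimura's twisted form, Birch's
# lemma with the period identity, and Birch's lemma for the `p`-adic `L`-functions of the pair

HONEST FRAMING (cell `bsd-f1-sign2`, WIDTH-5 attach seat `bsd-line-att-p4` g9, under the lead `bsd-line-att-p1`). BSD is NOT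
proved; C1 is NOT closed. THEOREMS ONLY; nothing asserted; `--supports stmt-BirchSwinnertonDyer-22296 --as helper`. Sequel of
`…AddTwistCoefficients` (`aₙ(A) = χ_d(n)aₙ(W)` for a twist ADDITIVE at the primes of `d`; `N_W ∣ N_A`, `d² ∣ N_A` when every
prime of `d` is `≥ 5` and BOTH curves are additive there). The tree's `…QuadraticTwistBirchSharedPrimesProofs` /
`…CongruenceAtTwoSharedPrimesProofs` §1 verbatim, with «`W` good or multiplicative at `d`» replaced by these two inputs:

* §3 `isNewformOf_twist_eq_charTwist_of_twist_additive`, `exists_ratPlusSymbol_twist_eq_sum_and_sq_of_twist_additive` — the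
  newform of `A` is `charTwist N_A f_W`; `[x]⁺_{f_A} = c·Σ_b χ_d(b)[x + b/d]⁺_{f_W}` WITH `c²·d·(Ω⁺_{f_A})² = (Ω⁺_{f_W})²`.
* §4 `isOrdinaryAt_twist_and_unitRoot_eq_of_twist_additive`, **`exists_padicLFunction_twist_eq_C_mul_padicLFunctionTame_and_sq_of_twist_additive`**
  — `A` is good ordinary at `p ∤ d` with `α_A = χ(p)α_W`, and `L_p(f_A, α_A) = C(c)·(1+T)^{−f_d}·L_p(f_W, d, α_W, χ_d)`, `c ≠ 0`,
  with the period identity.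
Part 4 (`…AddTwistKida`) combines this with `…AddTwistCongruence` (`L₂(f_W,ℓ,α_W,χ_ℓ) ≡ u·L₂(f_W,α_W) (mod 2Λ)`) and the
`2`-adic unit-ness of `c` (period unit at `2` on both sides + the `2`-adic part of Pal's theorem).

References: [MazurTateTeitelbaum1986Invent] §I.8, §I.11–I.13; [Shimura1971] Prop. 3.64; [AtkinLehner1970] §6; [SilvermanAEC2009]
X.2, App. C §16; [Matsuno2000] §2 (p. 84).
-/

set_option autoImplicit false
set_option linter.dupNamespace false

noncomputable section

open scoped Classical MatrixGroups ModularForm NumberTheorySymbols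

open CongruenceSubgroup NumberField IsDedekindDomain IsDedekindDomain.HeightOneSpectrum Rat.HeightOneSpectrum
  WeierstrassCurve PowerSeries Literature.NumberTheory.EllipticCurves Literature.NumberTheory.EllipticCurves.ModularForms
  Literature.NumberTheory.EllipticCurves.GreenbergVatsal2000
open Summit.BirchSwinnertonDyer.BirchSwinnertonDyer.Theorems.AlignedTransportAtTwoAddTwistCoefficients

namespace Summit.BirchSwinnertonDyer.BirchSwinnertonDyer.Theorems.AlignedTransportAtTwoAddTwistBirch

/-! ## §3 The newform of the twist and Birch's lemma with the period identity -/

section Birch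

variable (W : WeierstrassCurve ℚ) [W.IsElliptic] [W.IsGloballyMinimal] {d : ℤ} {A : WeierstrassCurve ℚ}
  [NeZero (W.conductorNorm ℤ)] [NeZero (A.conductorNorm ℤ)] [NeZero d.natAbs]
  {fW : CuspForm (Gamma0 (W.conductorNorm ℤ)) 2} {fA : CuspForm (Gamma0 (A.conductorNorm ℤ)) 2}

omit [W.IsGloballyMinimal] in
/-- **The newform of a both-additive twist is Shimura's twisted form `f_A = (f_W)_χ` at level `N_A`** (for the divisibility
witnesses `N_W ∣ N_A`, `d² ∣ N_A` of `conductorNorm_twist_dvd_of_additive`): both sides have `q`-expansion `Σ χ_d(n) aₙ(W) qⁿ`.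
[cite: Shimura1971, Prop. 3.64] -/
theorem isNewformOf_twist_eq_charTwist_of_twist_additive (hd4 : d % 4 = 1) (hsq : Squarefree d)
    (haddT : ∀ v : HeightOneSpectrum (𝓞 ℚ), ((primesEquiv v : ℕ) : ℤ) ∣ d →
      (W.quadraticTwist (d : ℚ)).HasAdditiveReductionAt v)
    {C : VariableChange ℚ} (hA : C • W.quadraticTwist (d : ℚ) = A)
    (hfW : IsNewformOf W fW) (hfA : IsNewformOf A fA)
    {χ : MulChar (ZMod d.natAbs) ℤ} (hχ : ∀ a : ZMod d.natAbs, χ a = J((a.val : ℤ) | d.natAbs))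
    (hq : (χ.ringHomComp (Int.castRingHom ℂ)).IsQuadratic)
    (hprim : DirichletCharacter.IsPrimitive (χ.ringHomComp (Int.castRingHom ℂ)))
    (hN : W.conductorNorm ℤ ∣ A.conductorNorm ℤ) (hm : d.natAbs ^ 2 ∣ A.conductorNorm ℤ) :
    fA = charTwist (A.conductorNorm ℤ) hN hm hq fW := by
  refine eq_of_forall_cuspCoeff_eq_gamma0 fun n ↦ ?_
  rw [cuspCoeff_charTwist (A.conductorNorm ℤ) hN hm hq hprim fW n, hfA.2 n, hfW.2 n,
    LFunction_twist_apply_complex_of_twist_additive W hd4 hsq haddT hA hχ n]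

omit [W.IsGloballyMinimal] in
/-- **Birch's lemma for a both-additive twist WITH the period identity**: for `d > 0`, `d ≡ 1 (mod 4)` square-free with every
prime of `d` at least `5` and BOTH `W`, `W^{(d)}` additive there, `A` a model of `W^{(d)}` and the newforms `f_W`, `f_A`: there is
ONE `c ∈ ℚ` with `[x]⁺_{f_A} = c · Σ_{b mod d} χ_d(b) · [x + b/d]⁺_{f_W}` for every `x`, and, as soon as some `[x]⁺_{f_A} ≠ 0`,
`c² · d · (Ω⁺_{f_A})² = (Ω⁺_{f_W})²`. The both-additive companion of `exists_ratPlusSymbol_twist_eq_sum_and_sq_sqfreeAt`.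
[cite: MazurTateTeitelbaum1986Invent, §I.8] [cite: Shimura1971, Prop. 3.64] -/
theorem exists_ratPlusSymbol_twist_eq_sum_and_sq_of_twist_additive (hd : 0 < d) (hd4 : d % 4 = 1) (hsq : Squarefree d)
    (h5 : ∀ v : HeightOneSpectrum (𝓞 ℚ), ((primesEquiv v : ℕ) : ℤ) ∣ d → 5 ≤ (primesEquiv v : ℕ))
    (haddW : ∀ v : HeightOneSpectrum (𝓞 ℚ), ((primesEquiv v : ℕ) : ℤ) ∣ d → W.HasAdditiveReductionAt v)
    (haddT : ∀ v : HeightOneSpectrum (𝓞 ℚ), ((primesEquiv v : ℕ) : ℤ) ∣ d →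
      (W.quadraticTwist (d : ℚ)).HasAdditiveReductionAt v)
    {C : VariableChange ℚ} (hA : C • W.quadraticTwist (d : ℚ) = A) (hfW : IsNewformOf W fW) (hfA : IsNewformOf A fA)
    {χ : MulChar (ZMod d.natAbs) ℤ} (hχ : ∀ a : ZMod d.natAbs, χ a = J((a.val : ℤ) | d.natAbs)) :
    ∃ c : ℚ, (∀ x : ℚ, ratPlusSymbol fA x =
        c * ∑ b : ZMod d.natAbs, (χ.ringHomComp (Int.castRingHom ℚ)) b * ratPlusSymbol fW (x + (b.val : ℚ) / d.natAbs)) ∧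
      ((∃ x : ℚ, ratPlusSymbol fA x ≠ 0) → (c : ℝ) ^ 2 * (d : ℝ) * plusPeriod fA ^ 2 = plusPeriod fW ^ 2) := by
  have hmd : (d.natAbs : ℤ) = d := Int.natAbs_of_nonneg hd.le
  have hodd : Odd d.natAbs := Int.natAbs_odd.mpr (Int.odd_iff.mpr (by omega))
  have hsq' : Squarefree d.natAbs := Int.squarefree_natAbs.mpr hsq
  have hm4 : d.natAbs % 4 = 1 := by omega
  obtain ⟨hq, hprim⟩ := mulChar_jacobi_complex_isQuadratic_isPrimitive hχ hodd hsq'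
  have heven : DirichletCharacter.Even (χ.ringHomComp (Int.castRingHom ℂ)) := by
    show (χ.ringHomComp (Int.castRingHom ℂ)) (-1) = 1
    rw [MulChar.ringHomComp_apply, mulChar_jacobi_apply_neg_one hχ hm4, map_one]
  have hg2 := gaussSum_jacobi_sq_eq hd hd4 hsq hχ
  obtain ⟨hN, hm, -⟩ := conductorNorm_twist_dvd_of_additive W hd4 hsq h5 haddW haddT hA
  have hFA := isNewformOf_twist_eq_charTwist_of_twist_additive W hd4 hsq haddT hA hfW hfA hχ hq hprim hN hm
  subst hFA
  obtain ⟨c, hc, hper⟩ := exists_rat_forall_ratPlusSymbol_charTwist_eq (A.conductorNorm ℤ) hN hm hq heven hprim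
    hfW.1 hfW.coeffField_eq_bot hfA.1 hfA.coeffField_eq_bot (fun u ↦ J((u.val : ℤ) | d.natAbs))
    (fun u ↦ by rw [MulChar.ringHomComp_apply, hχ, eq_intCast])
  have hsum : ∀ x : ℚ, ∑ b : ZMod d.natAbs, (χ.ringHomComp (Int.castRingHom ℚ)) b *
      ratPlusSymbol fW (x + (b.val : ℚ) / d.natAbs) =
      ∑ u : ZMod d.natAbs, (J((u.val : ℤ) | d.natAbs) : ℚ) * ratPlusSymbol fW (x + twistShift u) := by
    intro x
    refine Finset.sum_congr rfl fun b _ ↦ ?_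
    rw [MulChar.ringHomComp_apply, hχ, eq_intCast]
    rfl
  refine ⟨c, fun x ↦ by rw [hc x, hsum x], fun ⟨x, hx⟩ ↦ ?_⟩
  have hS : ∃ r : ℚ, ∑ u : ZMod d.natAbs, (J((u.val : ℤ) | d.natAbs) : ℚ) * ratPlusSymbol fW (r + twistShift u) ≠ 0 := by
    refine ⟨x, fun h0 ↦ hx ?_⟩
    rw [hc x, h0, mul_zero]
  have hP := hper hS
  have hsqP := congrArg (fun z : ℂ ↦ z ^ 2) hP
  rw [mul_pow, mul_pow, hg2] at hsqP
  have hdZ : ((d.natAbs : ℤ) : ℂ) = (d : ℂ) := congrArg (Int.cast : ℤ → ℂ) hmd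
  have hdC : ((d.natAbs : ℕ) : ℂ) = (d : ℂ) := by rw [← hdZ, Int.cast_natCast]
  rw [hdC] at hsqP
  apply Complex.ofReal_injective
  push_cast
  linear_combination hsqP

/-! ## §4 The twist is good ordinary at `2`; Birch's lemma for the `2`-adic `L`-functions -/

variable (p : ℕ) [Fact p.Prime]

omit [NeZero (W.conductorNorm ℤ)] [NeZero (A.conductorNorm ℤ)] [NeZero d.natAbs] in
/-- **`A = W^{(d)}` has good reduction at every good prime `p ∤ d` of `W`, and `a_p(A) = (p/|d|)·a_p(W)`** (both-additive twist;
`f_p(A) = f_p(W) = 0`, the coefficient identity at `n = p`). [cite: SilvermanAEC2009, X.2 and Exercise 10.16] -/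
theorem hasGoodReductionAtPrime_twist_and_frobeniusTrace_eq_of_twist_additive (hd4 : d % 4 = 1) (hsq : Squarefree d)
    (haddT : ∀ v : HeightOneSpectrum (𝓞 ℚ), ((primesEquiv v : ℕ) : ℤ) ∣ d →
      (W.quadraticTwist (d : ℚ)).HasAdditiveReductionAt v)
    {C : VariableChange ℚ} (hA : C • W.quadraticTwist (d : ℚ) = A) [A.IsElliptic] [A.IsGloballyMinimal]
    (hgood : W.HasGoodReductionAtPrime p) (hpd : ¬ (p : ℤ) ∣ d) :
    A.HasGoodReductionAtPrime p ∧ A.frobeniusTrace p = J((p : ℤ) | d.natAbs) * W.frobeniusTrace p := by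
  have hp : p.Prime := Fact.out
  have hd0 : (d : ℚ) ≠ 0 := by exact_mod_cast (show d ≠ 0 by rintro rfl; norm_num at hd4)
  haveI := W.isElliptic_quadraticTwist hd0
  have hpN : ¬ p ∣ W.conductorNorm ℤ := fun h ↦ (W.dvd_conductorNorm_iff_not_hasGoodReductionAtPrime p).mp h hgood
  set vp : HeightOneSpectrum ℤ := (primesEquiv (R := ℤ)).symm ⟨p, hp⟩ with hvp
  have hgenp : natGenerator vp = p :=
    congrArg (fun q : Nat.Primes ↦ (q : ℕ)) ((primesEquiv (R := ℤ)).apply_symm_apply ⟨p, hp⟩)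
  have hfac := W.factorization_conductorNorm_quadraticTwist_eq_of_not_dvd hd4 vp (by rw [hgenp]; exact hpd)
  rw [hgenp] at hfac
  have hNA : A.conductorNorm ℤ = (W.quadraticTwist (d : ℚ)).conductorNorm ℤ := by
    rw [← hA]; exact WeierstrassCurve.conductorNorm_smul ℤ _ C
  have hpNA : ¬ p ∣ A.conductorNorm ℤ := by
    intro h
    rw [hNA] at h
    have hpos : 0 < ((W.quadraticTwist (d : ℚ)).conductorNorm ℤ).factorization p :=
      Nat.Prime.factorization_pos_of_dvd hp ((W.quadraticTwist (d : ℚ)).conductorNorm_pos_holds).ne' h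
    rw [hfac] at hpos
    exact hpN (Nat.dvd_of_factorization_pos (Nat.pos_iff_ne_zero.mp hpos))
  have hgoodA : A.HasGoodReductionAtPrime p := by
    by_contra h
    exact hpNA ((A.dvd_conductorNorm_iff_not_hasGoodReductionAtPrime p).mpr h)
  refine ⟨hgoodA, ?_⟩
  have h := LFunction_twist_apply_of_twist_additive W hd4 hsq haddT hA p
  rwa [LFunction_apply_prime_eq_frobeniusTrace A p hgoodA, LFunction_apply_prime_eq_frobeniusTrace W p hgood] at h

omit [NeZero (W.conductorNorm ℤ)] [NeZero (A.conductorNorm ℤ)] [NeZero d.natAbs] in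
/-- **The both-additive twist is good ORDINARY at `p ∤ d`, with unit root `α_A = (p / |d|)·α_W`** (`p` a good ordinary prime of
`W`). [cite: MazurTateTeitelbaum1986Invent, §I.11 (allowable root)] -/
theorem isOrdinaryAt_twist_and_unitRoot_eq_of_twist_additive (hd4 : d % 4 = 1) (hsq : Squarefree d)
    (haddT : ∀ v : HeightOneSpectrum (𝓞 ℚ), ((primesEquiv v : ℕ) : ℤ) ∣ d →
      (W.quadraticTwist (d : ℚ)).HasAdditiveReductionAt v)
    {C : VariableChange ℚ} (hA : C • W.quadraticTwist (d : ℚ) = A) [A.IsElliptic] [A.IsGloballyMinimal]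
    (hord : IsOrdinaryAt W p) (hpd : ¬ (p : ℤ) ∣ d) :
    IsOrdinaryAt A p ∧ unitRoot A p = (J((p : ℤ) | d.natAbs) : ℤ_[p]) * unitRoot W p := by
  have hp : p.Prime := Fact.out
  obtain ⟨hgoodA, haA⟩ :=
    hasGoodReductionAtPrime_twist_and_frobeniusTrace_eq_of_twist_additive W p hd4 hsq haddT hA hord.1 hpd
  set s : ℤ := J((p : ℤ) | d.natAbs) with hs
  have hpm : ¬ p ∣ d.natAbs := fun h ↦ hpd (Int.natCast_dvd.mpr h)
  have hs2 : s ^ 2 = 1 :=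
    jacobiSym.sq_one (by rw [Int.gcd_natCast_natCast]; exact (Nat.Prime.coprime_iff_not_dvd hp).mpr hpm)
  have hordA : IsOrdinaryAt A p := by
    refine ⟨hgoodA, fun h ↦ hord.2 ?_⟩
    rw [haA] at h
    have h' := h.mul_left s
    rwa [← mul_assoc, ← sq, hs2, one_mul] at h'
  refine ⟨hordA, ?_⟩
  have hEU := existsUnique_unitRoot A p hordA
  have hspecA := unitRoot_spec_holds A p hordA
  have hspecW := unitRoot_spec_holds W p hord
  have hs2' : (s : ℤ_[p]) ^ 2 = 1 := by exact_mod_cast hs2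
  have hβ : ((s : ℤ_[p]) * unitRoot W p) ^ 2 - (A.frobeniusTrace p : ℤ_[p]) * ((s : ℤ_[p]) * unitRoot W p) + p = 0 ∧
      IsUnit ((s : ℤ_[p]) * unitRoot W p) := by
    refine ⟨?_, ?_⟩
    · rw [haA]
      push_cast
      linear_combination (unitRoot W p ^ 2 - (W.frobeniusTrace p : ℤ_[p]) * unitRoot W p) * hs2' + hspecW.1
    · exact (isUnit_iff_exists_inv.mpr ⟨(s : ℤ_[p]), by rw [← sq, hs2']⟩).mul hspecW.2
  exact hEU.unique hspecA hβ

/-- **Birch's lemma for the `p`-adic `L`-function of a BOTH-ADDITIVE twist, WITH the period identity** (`p` a good ordinary prime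
of `W`, `p ∤ d`; `d > 0`, `d ≡ 1 (mod 4)` square-free, every prime of `d` at least `5`, `W` and `W^{(d)}` both additive there;
`m = d`, `χ_d = (· / m)`): for some `c ∈ ℚˣ`, `L_p(f_A, α_A, T) = C(c)·(1+T)^{−f_m}·L_p(f_W, m, α_W, χ_d, T)` AND
`c²·d·(Ω⁺_{f_A})² = (Ω⁺_{f_W})²`. The both-additive companion of `exists_padicLFunction_twist_eq_C_mul_padicLFunctionTame_and_sq_sqfreeAt`.
[cite: MazurTateTeitelbaum1986Invent, §I.8 and §I.11–I.13] [cite: Matsuno2000, §2 (p. 84)] -/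
theorem exists_padicLFunction_twist_eq_C_mul_padicLFunctionTame_and_sq_of_twist_additive (hd : 0 < d) (hd4 : d % 4 = 1)
    (hsq : Squarefree d)
    (h5 : ∀ v : HeightOneSpectrum (𝓞 ℚ), ((primesEquiv v : ℕ) : ℤ) ∣ d → 5 ≤ (primesEquiv v : ℕ))
    (haddW : ∀ v : HeightOneSpectrum (𝓞 ℚ), ((primesEquiv v : ℕ) : ℤ) ∣ d → W.HasAdditiveReductionAt v)
    (haddT : ∀ v : HeightOneSpectrum (𝓞 ℚ), ((primesEquiv v : ℕ) : ℤ) ∣ d →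
      (W.quadraticTwist (d : ℚ)).HasAdditiveReductionAt v)
    {C : VariableChange ℚ} (hA : C • W.quadraticTwist (d : ℚ) = A) [A.IsElliptic] [A.IsGloballyMinimal]
    (hfW : IsNewformOf W fW) (hfA : IsNewformOf A fA) (hord : IsOrdinaryAt W p) (hpd : ¬ (p : ℤ) ∣ d)
    {χ : MulChar (ZMod d.natAbs) ℤ} (hχ : ∀ a : ZMod d.natAbs, χ a = J((a.val : ℤ) | d.natAbs)) :
    ∃ c : ℚ, c ≠ 0 ∧ padicLFunction fA (unitRoot A p : ℚ_[p]) =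
      PowerSeries.C (c : ℚ_[p]) * PowerSeries.binomialSeries ℚ_[p] (-frobeniusExponent p (d.natAbs : ℤ_[p])) *
        padicLFunctionTame fW d.natAbs (unitRoot W p : ℚ_[p])
          ((χ.ringHomComp (Int.castRingHom ℚ)).ringHomComp (Rat.castHom ℚ_[p])) ∧
      (c : ℝ) ^ 2 * (d : ℝ) * plusPeriod fA ^ 2 = plusPeriod fW ^ 2 := by
  have hp : p.Prime := Fact.out
  obtain ⟨c, hB, hper⟩ :=
    exists_ratPlusSymbol_twist_eq_sum_and_sq_of_twist_additive W hd hd4 hsq h5 haddW haddT hA hfW hfA hχ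
  have hxA : ∃ x : ℚ, ratPlusSymbol fA x ≠ 0 := exists_ratPlusSymbol_ne_zero hfA.1 hfA.coeffField_eq_bot
  have hc0 : c ≠ 0 := by
    rintro rfl
    obtain ⟨x, hx⟩ := hxA
    exact hx (by rw [hB x, zero_mul])
  obtain ⟨hordA, hαA⟩ := isOrdinaryAt_twist_and_unitRoot_eq_of_twist_additive W p hd4 hsq haddT hA hord hpd
  obtain ⟨hαeq, hαu, -⟩ := unitRoot_coe_spec (W := W) hord
  have hpN : ¬ p ∣ W.conductorNorm ℤ := not_dvd_level_of_isNewformOf hfW hord.1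
  have hpm : ¬ p ∣ d.natAbs := fun h ↦ hpd (Int.natCast_dvd.mpr h)
  have hmp : d.natAbs.Coprime p := Nat.coprime_comm.mp ((Nat.Prime.coprime_iff_not_dvd hp).mpr hpm)
  have hap : cuspCoeff fW p = ((W.frobeniusTrace p : ℤ) : ℂ) :=
    cuspCoeff_eq_frobeniusTrace_of_isNewformOf_holds hfW hord.1
  have hχp : (χ.ringHomComp (Int.castRingHom ℚ)) (p : ZMod d.natAbs) ^ 2 = 1 := by
    rw [MulChar.ringHomComp_apply, ← map_pow, mulChar_jacobi_apply_natCast_sq hχ p hmp.symm, map_one]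
  have key := padicLFunction_twist_eq_of_birch fW fA hfW.1 hfW.coeffField_eq_bot hpN hmp hap hαeq hαu
    (χ.ringHomComp (Int.castRingHom ℚ)) hχp hB
  have hαA' : (unitRoot A p : ℚ_[p]) =
      (((χ.ringHomComp (Int.castRingHom ℚ)) (p : ZMod d.natAbs) : ℚ) : ℚ_[p]) * (unitRoot W p : ℚ_[p]) := by
    rw [hαA, MulChar.ringHomComp_apply, mulChar_jacobi_apply_natCast hχ p, eq_intCast]
    push_cast
    rfl
  exact ⟨c, hc0, by rw [hαA']; exact key, hper hxA⟩

end Birch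



end Summit.BirchSwinnertonDyer.BirchSwinnertonDyer.Theorems.AlignedTransportAtTwoAddTwistBirch

end
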